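import Mathlib.LinearAlgebra.FiniteDimensional.Lemmas
import Mathlib.LinearAlgebra.Dimension.Finrank

/-!
# Venture HSemireg — ONE typed obstruction statement (D-0034): what obstructs semiregularity of Weil representatives on non-split components

HONEST FRAMING. v1.1 FROZEN 2026-08-25 (p10 g6, D-0034 pen; ref-4 g65 audit CLEAN, wording (W5)/(W6) applied; δ-convention fixed per s4-prove-1 g14) (p10 g6, fallback OBSTRUCTION PEN, 2026-08-25; lead g13 tasking bus l.23505 (4)(b); W4 input
`widen/W4/w4lat1g20/obst/OBSTRUCTION-W4INPUT-w4lat1g20.md` §4 «Option R»; pre-reads ref-4 g65 l.23595 (F1–F7) and w4-lat-1 g20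
READ-P10-SKELETON-v0 (R1–R6) folded into the docstrings — no statement changed).  Finite-dimensional LINEAR ALGEBRA ONLY:
no variety, sheaf, complex, Atiyah class or semiregularity map is constructed here; the fields of the datum below are ABSTRACT and
the three named hypothesis shapes (H-BF), (H-H), (H-V) say what geometry supplies — exactly in the style of
`ObstructionLocusGraph.ReduciblePointObject`.  Nothing here says that HC / HC_CM / HC_AV holds or fails; no door / tier word is
minted; the sixteen NEG instances are CITED in the docstring roster (texts = the signing seats' and t-1's), nothing is re-proved.

THE STATEMENT IN WORDS (W4 §4, adopted as the draft; the roster of instances is t-1 g20's (4)(a), to be pasted below before the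
bytes freeze).  CONVENTION: `δ := (−1)ⁿ·disc(H) ∈ ℚ^×⧸Nm(K^×)` is the POSITIVELY NORMALISED discriminant class of the component, so
that SPLIT ⟺ `δ ∈ Nm(K^×)` ([Del82 Cor. 4.2], [Mar25b §11.5 Step 1], the cell's lit/WEIL-DEF.md §1.4 «sign hazard»); in the TREE's raw
convention (`ComplexTorus.IsPolarizedWeilType.discriminant` = class of `det Ψ`) the split class is `(−1)ⁿ·Nm(K^×)`, and the
`SecantParity` declarations cited below speak the raw convention.  «Let `A` be a polarised abelian variety of Weil type `(n, K)`,
`n ≥ 2`, on a component of discriminant class `δ ∉ Nm(K^×)` (NON-SPLIT, positive normalisation), and `G` an object on `A` with a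
semiregularity map `σ_G : Ext²(G,G) → ⊕_q H^{q+2}(Ω_A^q)`.  Call `G`
CLASS-EXACT if `ch_k(G) ∈ ℚ·h^k` for every `k ≠ n` (`0 ≤ k ≤ 2n`) and `ch_n(G) ∈ ℚ·hⁿ ⊕ W_K ⊗ ℂ` (rational Chern character, never a
ℤ-lattice condition), a WEIL REPRESENTATIVE if moreover the `W_K`-component of `ch_n(G)` is non-zero, and `h`-FREE if `ch_k(G) = 0` for
every `0 < k < 2n`, `k ≠ n`, and `ch_n(G) ∈ W_K ⊗ ℂ` (no `hⁿ`-part; rank `ch₀` and the point class `ch_{2n}` unconstrained — the meaning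
of `VoisinBarrierHFree`; so `h`-free ∧ `W`-carrying ⇒ class-exact).  Then `σ_G` is injective ONLY IF (i) `G` is not `h`-free [the Voisin
barrier — `VoisinBarrierHFree`, an OPEN `@[conjecture]` named statement of the cell: prong (V) is CONDITIONAL on it] and (ii) `G` is
first-order unobstructed along EVERY direction of the `n²`-dimensional polarised Weil family `S_K` through `A`: `⟨κ, At G⟩ = 0` for all
`κ ∈ T_A S_K` [KS-TEST, PROVED here from the two hypothesis shapes: Buchweitz–Flenner 2003 Prop. 4.2 / Cor. 4.3 `σ_G⟨κ, At G⟩ = ± κ⌟ch G`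
and THEOREM H «`h` and `W_K` stay Hodge along `S_K`»].  Every family of representatives constructed in the cell on non-split components
(NEG #1–#16) either has NO Weil representative among its members (class arithmetic, LAW B: decomposable `W`-classes need `δ ∈ Nm`, i.e. SPLIT), or
has NO member at all (existence-NO), or is `h`-free and violates (i), or violates (ii): its members are GOVERNED by special structure
(a CM corner, an isogeny decomposition, a product, a curve, extra Néron–Severi) and follow only that structure's sub-family `S_𝔖 ⊊ S_K`,
so that `rank ⟨T_A S_K, At G⟩ ≥ n² − dim S_𝔖 > 0` (RIGIDITY EXCESS).»

WHAT IS TYPED.  `WeilRepresentativeDatum`: the linear-algebra shadow of `(A, G)` — `ob = ⟨·, At G⟩ : T_A S_K → Ext²(G,G)`,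
`sigma = σ_G`, `contr = κ ↦ ±κ⌟ch(G)` on `T_A S_K`, and the three class predicates; hypothesis shapes `HBF` (`σ ∘ ob = contr`),
`HH` (class-exact ⇒ `contr = 0`), `HV` (the Voisin barrier in datum form); **`Obstruction D`** := class-exact ∧ W-carrying ∧
(h-free ∨ rigidity excess positive) — THE ONE STATEMENT's antecedent; **`not_injective_of_obstruction`**: under (H-BF), (H-H), (H-V),
`Obstruction D → ¬ Injective σ` (and no part `π ∘ σ` is injective, `not_injective_comp_of_obstruction`); the words' «only if (i)
and (ii)» literally (`necessary_of_injective`: injective `σ_G` ⇒ `¬ hFree ∧ ob = 0`); the quantitative forms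
**`finrank_ker_sigma_ge`** (`dim ker σ_G ≥ e_K(G) := rank ob`) and **`rigidityExcess_ge_of_governed`** (governed by `S_𝔖` ⇒
`e_K(G) ≥ n² − dim T_A S_𝔖`).  WHAT IS PROVED vs ASSUMED (ref-4 g65 F1 / W4 R4 (a)): the (Σ) prong — necessity of (ii) — is PROVED from
(H-BF) + (H-H) by rank–nullity; the (V) prong — necessity of (i) — is (H-V) ITSELF, i.e. ASSUMED: for a finite locally free `E` the
hypothesis `HV` of its datum is DISCHARGED by `VoisinBarrierHFree.exists_ne_zero_of_hFree` / `.not_isISemiregular_univ`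
(`VoisinBarrierStatement.lean`) — conditional on the open statement `VoisinBarrierHFree` — and for complexes it is words only
(`SemiregularityTheorems.lean` scope (R4)(R7)); every (V)-tagged roster row below says «conditional on VoisinBarrierHFree».
THE ROSTER IS LOAD-BEARING (ref-4 F2): the zero datum with the three predicates `True` satisfies all hypotheses trivially — the datum
does not pin `σ_G`; content enters row by row through the tree declarations that SUPPLY `sigma`/`ob` for the family and DISCHARGE
`hgov` + `hlt` (prong (Σ), e.g. `ObstructionLocus.ReduciblePointObject.not_semiregular_of_pair_type` with its (H-arr), (H-NC),
connectedness hypotheses restated) or `HV` (prong (V)); a row without declaration names is UNPLACED.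
SCOPE — WHY «NON-SPLIT» (STRUCTURE D6, the SPLIT-ONLY MECHANISM, a TREE theorem; s4-prove-1 g14 bus l.23686): every `K`-secant triple
`(X × X̂, K = ℚ(A), N·(±Ξ_P))` — every `X`, every secant direction, every `d`, `K`-isogeny classes included — has discriminant
`[(−1)^{dim X}] ∈ ℚˣ ⧸ Nm(Kˣ)` IN THE RAW CONVENTION (`Summit.Ventures.HSemireg.SecantParity.discriminant_smul_Xi` /
`discriminant_smul_neg_Xi` / `discriminant_eq_of_isIsogeny_of_blockGram`, `SecantParityWeilTypeDiscriminant.lean`; [Mar25 Lemma 3.1.3]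
at object level) — i.e. exactly the split class, `δ = 1 ∈ Nm(K^×)` in the positive normalisation — and is of split Weil type
(`SecantParity.exists_isotropic_half_smul_Xi`, `SecantParityWeilTypeSplit.lean`): on a NON-SPLIT component (`δ ∉ Nm(K^×)`; raw: disc
`≠ (−1)ⁿ·Nm`) a Weil representative is NEVER of secant type (sheaf, complex, twisted, or `K`-isogenous image of a secant triple), so the
datum below ranges over NON-secant representatives, and NEG #1–#16 are its family-scoped instances.
BINDER NOTES (W4 §4 (c1)–(c3)): `wCarrying` is the relevance hypothesis (unused by the mechanism, kept so that line bundles are not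
«counter-examples»); `TSK` is the tangent space of the POLARISED Weil family (`n²`), not of `K`-tori (`2n²`) nor of `𝒜_{2n}`;
`δ` / «non-split» is used by NO step — it only restricts which instances exist — and is therefore NOT a binder (it lives in the title,
the words and the roster).  FILING PATH: kept under `Summits/Ventures/HSemireg/` like its precedent `ObstructionLocusGraph.lean`
(the advisory audit classes «vendored-fact» for the untagged hypothesis-shape `def … : Prop`s and «orphan» are accepted as there; W4 R1 (o2)).
ROSTER OF THE SIXTEEN (NEG #1–#16) — SOURCE: t-1 g20's WORDS ROSTER, bus l.23671 + ADDENDUM 1 l.23675 (2026-08-25; scope ·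
hypotheses · tier · locator · tree decls «as printed»; texts inside «…» there are verbatim from SIGNSHEET-2000Z / CHECKPOINT / PLAN / VERDICT).
The KIND and prong on each row below are THE PEN's READING of those words (audited by ref-4; t-1 records the outcome); «decls: none
printed» = the signed text names no Lean declaration ⇒ the row is WORDS-ONLY (UNPLACED by declaration in ref-4's sense F2) and is an
instance of `Obstruction` on paper, not in the kernel.  COUNT (the pen's, over t-1's sixteen numbers): k_Σ = 9 (#1 #2 #3 #5 #8 #11 #12
#14 #15; #1, #5, #8 also carry a class-level (B) half), k_V = 1 (#13, CONDITIONAL on `VoisinBarrierHFree`), k_B = 2 (#4 #7), k_∄ = 2 (#9,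
#10-W — #10-W CONDITIONAL on the W-laws; the unconditional #10 NOT SIGNED), OPEN/candidate = 1 (#6, content inside #1), LAW on every
component (necessary condition on supports, outside the three prongs) = 1 (#16); 9 + 1 + 2 + 2 + 1 + 1 = 16.  By t-1's record:
SIGNED UNCONDITIONAL 13, SIGNED CONDITIONAL 2 (#13, #10-W), NOT SIGNED 1 (#6).
* NEG #1 — KIND INSTANCE-(Σ) + CLASS-LEVEL (B).  «NO — on a NON-split Weil-type component no object produced by the secant♯/box
  mechanism Φ(F₁ ⊠ F₂) from semiregular inputs on the factors is semiregular for the Weil class»; scope «the box/secant mechanism at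
  product decompositions compatible with the CM field; it does not assert that any published programme fails».  (Σ): derivation 1
  (TWISTED-KUNNETH / Q824-NO: the Weil tangent is MIXED in every complementary frame off the `G±(a)` frames, hyperbolic iff split — boxes
  of linear objects are first-order obstructed along the mixed Weil directions; `S_𝔖` = the `K`-compatible product locus); (B):
  derivations 2–3 (isotropic-sublattice criterion, κ-barrier: no W-alive class-exact box class unless `δ ∈ Nm` = LAW B).  TIER SIGNED
  2026-08-22T20:01:33Z bus l.5057, R-50 (a); SIGNSHEET §1.  decls: none printed in the signed text; TREE CARRIERS of the two halves
  (offered by their lineages, not the signed text's): (B) = D6 `SecantParity.discriminant_smul_Xi` / `exists_isotropic_half_smul_Xi`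
  (secant type ⇒ split); (Σ) nearest shape `ObstructionLocusKodaira.finrank_range_kodairaMap_pp` (the `C(n,2)` obstructed mixed pp
  directions at the reducible point).
* NEG #2 — KIND INSTANCE-(Σ).  «W_d-designs on Jacobians NOT semiregular for n ≥ 4 (LT-rigidity; R-20/R-21)»: `F = I_Z ⊗ L`, `Z` a
  `G`-orbit of translates of `W_{n−2} ⊂ J(C)`, objects locally isomorphic to `I_Z` near `Z`; `ξ₀ ∈ T𝒜_g ∖ T𝓜_g` obstructs (`S_𝔖` = the
  Jacobian locus; `e₂^G ≥ n(n−1)+(n−2)(n−3)/2` corroborates); Jacobians only, `n ≥ 4`, partial normalisations `F′` NOT covered,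
  «Lemma-dead ≠ not semiregular».  TIER «CLOSED AS A SIZED NEGATIVE» R-20, PLAN l.657/l.674.  decls: none printed.
* NEG #3 — KIND INSTANCE-(Σ) (literally `RigidityExcessPos`).  The Prong-C object `Z̄ = ⋃ḡ^j(Θ×C) ⊂ (B×B, η̄, h̄)` at the cyclic-cubic
  Picard points «is first-order obstructed along the Weil locus: can_{Z̄}(ξ) ≠ 0 for ξ in a non-empty open cone of T_W» (need 3, have
  ≤ 2), «Consequently Z̄ is not Bloch/τ₃-semiregular … the Bloch door at the Picard points of the cyclic-cubic locus is closed for this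
  object»; this object, this anchor, flat, no lci hypothesis.  TIER SIGNED R-24 (a), PLAN l.742.  decls: none printed.
* NEG #4 — KIND CLASS-LEVEL NO (B) (discriminant class).  «PRONG D: δ constant (= split) on the rational Spin/Clifford orbit (R-22b)» —
  the orbit never leaves the split class, so the construction yields no Weil representative on a non-split component.  TIER «PRONG D
  CLOSED», PLAN l.706.  decls: none printed.
* NEG #5 — KIND INSTANCE-(Σ) (with a (B) case).  R-28 (a): «At any three-surface product anchor S₁×S₂×S₃ … no effective lci cycle
  assembled from curve-triples, their translates, η-images and u-free paddings — WITHOUT shear images — is class-exact (a·h³ + w,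
  w ≠ 0) and first-order unobstructed along T_W, in all four slot patterns» (case 3 dead BY CLASS via the isotropy lemma); this
  catalogue at these anchors; placement companion = pointer only.  TIER SIGNED (seat derivation + referee REVIEW-L23-1), PLAN l.786.
  decls: none printed.
* NEG #6 — KIND OPEN (CANDIDATE, NOT SIGNED, R-110 (c)): «THEOREM A twisted-Künneth frames» — its content is derivation 1 inside NEG #1.
* NEG #7 — KIND CLASS-LEVEL NO (B).  «no untwisted line-bundle-generated K-class on (3;1⁵2)/S³ is class-exact ∧ W-alive INSIDE the
  rigid-object windows» (W-values quantised in `L_W = 3·O_K`; both windows empty; GEN-LATTICE ×3); scope: nothing about LARGE-W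
  line-bundle classes, determinant-twisted designs, non-line-bundle-generated objects, the ι(−1)/μ₂ window; «UNTWISTED».  TIER SIGNED
  2026-08-22T14:00Z, CHECKPOINT §0′.13.  decls: none printed.
* NEG #8 — KIND INSTANCE-(Σ) (literally `ob κ ≠ 0 ∧ σ(ob κ) = 0`) + CLASS-LEVEL (B) at the (T4) anchors.  REVIEW-R5-1 §4 verbatim: (ii)
  «on ANY member X of a Weil-type sixfold component (3,K,δ), a scheme-theoretic complete intersection Z = D₁∩D₂∩D₃ of three AMPLE
  Cartier divisors … whose class [Z] = r h₀³ + w stays Hodge along T_W with some [D_i] ∉ ℚh₀ — in particular every such Z with w ≠ 0 —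
  is NOT semiregular: for ξ ∈ T_W with ξ⌟[D_i] ≠ 0 … Bloch's obstruction ob_Z(ξ) ∈ H¹(Z,N_Z) is non-zero … while π(ob_Z(ξ)) = ξ⌟[Z] = 0»
  (`S_𝔖` = {ξ : ξ⌟[D_i] = 0 ∀ i}, the locus where the divisors stay algebraic); (i) class side at the (T4) anchors: no triple of divisor
  classes has `D₁D₂D₃ = r h₀³ + w`, `w ≠ 0`.  Scope: disjoint unions dead by the same kernel; glued configurations, non-ample divisors,
  sheaves/complexes NOT covered; ι(−1)-invariant witness.  TIER SIGNED 2026-08-22T08:24:35Z R-47 (a), PLAN l.945.  decls: none printed.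
* NEG #9 — KIND EXISTENCE-NO (∄).  «F₁₀₈ contains no lci configuration at any placement in S³ (torsion included) — two independent sieves
  0/512» + budget-free 19-node route; scope «an lci-sieve / SAT statement relative to the lego_s3 / c9sat5 obligation rule set of
  record … not a first-order-admissibility claim» (sieves placement-free).  TIER SIGNED bus l.5058 (machine ×2); SIGNSHEET §2.  decls:
  none (machine record, not kernel).
* NEG #10-W — KIND EXISTENCE-NO (∄), CONDITIONAL on the W-laws (W1)–(W3).  U(3;cube) door, `X = Γ₁³@0` pinned, 40-way pinpair split:
  «the corrected rule set (R1)(R2) together with (W1)–(W3) admits NO configuration in any of the 40 pinned cases — UNSAT 40∕40 from two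
  columns … DRAT …; NOT CLAIMED: the no-W form»; the UNCONDITIONAL NEG #10 is NOT SIGNED (R-108 (d)(i)); door (I) word of record PASS 156
  (b).  TIER SIGNED CONDITIONAL R-110 (a), PLAN l.1428.  decls: none (SAT ∕ DRAT certificates are machine artefacts).
* NEG #11 — KIND INSTANCE-(Σ) (confinement, with the W-dead alternative = (B)).  DOOR #5, E-trivial / liftable-split Porteous loci at
  the (3,3) Weil-type CM anchors: «no class-exact W-alive Porteous / Eagon–Northcott locus Z = D_{e−1}(φ) … with E liftable along T_W
  after a twist … is semiregular on any (3,3) Weil component — every f, N, e, every point: dead by THEOREM P» (THEOREM P: if `Z`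
  deforms to first order along a polarisation-preserving `ξ` then `ξ⌟m_i = 0` for every `i` — `S_𝔖` = the Néron–Severi locus of the
  `M_i`; semiregular ∧ class-exact ⇒ deforms along all of `T_W` ⇒ every `m_i ∈ ℚh` ⇒ `[Z] ∈ ℚh³`, W-dead).  TIER SIGNED bus l.5059
  (THEOREM P ×3 + COUNT v2), SIGNSHEET §3.  decls: none printed in the signed text.
* NEG #12 — KIND INSTANCE-(Σ) (confinement; THEOREM N″).  «On any (3,3) Weil-type component (K, a), at every point A: no SPLIT Porteous
  locus Z = D_{e−1}(φ), φ : E = ⊕ N_a → F = ⊕ M_i (f = e + 2) generic … is simultaneously Bloch-semiregular …, class-exact and W-alive —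
  for every e ≥ 1 and every choice of the N_a, M_i»; scope «split E and F with f = e + 2 only; only Weil-geometry input (U2.1)».
  TIER SIGNED bus l.5060 (THEOREM N″, th-5; reads ×2), SIGNSHEET §4.  decls printed in the signed text: none; TREE CARRIER OF THE
  MECHANISM (s4-prove lineage, every rung `n ≥ 3`): `Summit.Ventures.HSemireg.….SplitPorteousShapes.not_semiregular_classExact_wAlive`
  (`PorteousConfinement.lean`: under the named shapes — its HYPOTHESIS FIELD `blochExact : Semiregular → ClassExact → ∀ ξ ∈ TW,
  Deforms ξ` is what this file's theorem `ob_eq_zero_of_injective` SUPPLIES, reading `Deforms ξ` as `ob ξ = 0` ((H-BF)+(H-H)) —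
  «semiregular ∧ class-exact ⇒ every letter difference on K∙h ⇒ [Z] ∈ K∙hⁿ ⇒ W-dead»), with `….deforms_iff` (`{ob = 0} = T^pair`,
  the governing `TS𝔖`).
* NEG #13 — KIND INSTANCE-(V), CONDITIONAL on `VoisinBarrierHFree` (OPEN `@[conjecture]`).  The ten h-FREE family-B product-law (q = 0)
  design files + the product laws at q = 0: the UNTWISTED members («c₁ = 0, ℬ locally free of rank r > 0, iterated extensions of line
  bundles, ch = R + w h-free and W-carrying, n ≥ 2») by THEOREM V — «σ_I is not injective for any I, for ANY gluing»; the TWISTED /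
  DESCENDED members by T5-23 (V-tw); NOT family B as such (the h-seeing designs B12-9/9b/9c/10 are OUTSIDE this negative = the live
  family-B door).  TIER SIGNED CONDITIONAL bus l.5061 («seat-theorem, CONDITIONAL on THEOREM V as derived»), SIGNSHEET §5.  decls PRINTED
  IN THE SIGNED TEXT: `Summit.Ventures.HSemireg.VoisinBarrierHFree` (p330615) and `VoisinBarrier C` (p330910), equivalent in the kernel
  (`voisinBarrierHFree_iff`, p332340); `VoisinBarrierKappa C` (T5-23, p331684); consumers: `VoisinBarrierHFree.not_isISemiregular_univ` /
  `.exists_ne_zero_of_hFree` (`VoisinBarrierStatement.lean`; first binder `(hV : VoisinBarrierHFree)`) discharge this file's `HV` UNDER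
  `VoisinBarrierHFree`, for data built from a finite locally free `E` with `h`-free `W`-carrying `ch` on a `2n`-dimensional `A` with
  `φ ≫ φ = −d`.
* NEG #14 — KIND INSTANCE-(Σ) (confinement; THEOREM SQ″ + transposition; v1-min SIGNED bus l.5062, v2 = CELL NEGATIVE OF RECORD R-108 (b)).
  «On any (4,4) Weil-type component (K, a), at every point A: no SPLIT Porteous locus Z = D_{e−r}(φ) … of middle codimension
  r(f − e + r) = 4 — types (1,4), (2,2), (4,1) … and, ONLY for the type (2,2) [with the printed ampleness / «one of the two spreads
  dominated» hypotheses], is simultaneously Bloch-semiregular, class-exact and W-alive …; the same on any (3,3) component for the types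
  (1,3) and (3,1)»; «every point» = every point of the Weil-type component; OPEN RESIDUE printed: doubly-spread (2,2) designs.  TIER per
  type as printed (refereed / th-5 N″ ×3 / hand + machine ×3), PLAN l.1407.  decls: none printed.
* NEG #15 «SQ-sh» — KIND INSTANCE-(Σ) (confinement; THEOREM SQ-sh, [Muk78]; CELL NEGATIVE OF RECORD R-108 (c)).  «On any (n,n) Weil-type
  component (n = 3, 4; and n = 5, 6 for e ≤ 40 in the hook types (1,n)∕(n,1)), at every point A: no Porteous locus Z = D_{e−r}(φ) of
  middle codimension n = r(f − e + r), φ : E → F = ⊕ F_i general …, E SEMI-HOMOGENEOUS (Mukai) of slope δ and every F_i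
  semi-homogeneous of slope μ_i with μ_i − δ ample … is simultaneously Bloch-semiregular, class-exact and W-alive»; falsifier «such a
  design with μ_i − δ ∉ ℚh and a two-code injectivity certificate».  TIER as printed, PLAN l.1408.  decls: none printed (both proofs
  machine-checked by seat code, not kernel).
* NEG #16 — KIND LAW (a NECESSARY CONDITION ON SUPPORTS, EVERY Weil-type component, n ≥ 2, split or not — outside the three prongs;
  CELL NEGATIVE OF RECORD R-110 (b)).  «On any member of any Weil-type component (n ≥ 2), a class-exact ∧ semiregular coherent sheaf
  carries non-generic class only on divisorially-chained clusters of support pieces that are class-exact as wholes in every degree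
  below the codimension of their contact with the rest; in particular every support component of dimension ≥ 2 in codimension-≥ 2
  contact with the rest has generic class, for every singularity type, scheme structure and dressing» (W1-tw THEOREM CC∞ and its
  Γ-form; «nothing about σ; … produces no object and no σ-rank»; [BF03] Thm 5.1 spreading over the smooth germ of the Weil component).
  It instantiates this file's predicate only through its contrapositive on a given family (a W-alive object violating the support law
  is not class-exact ∧ semiregular); TIER = t-1 PASS 135 (a).  decls printed in the record (kernel INPUTS to CC∞, not the law):
  `Summit.Ventures.HSemireg.BranchColouring.twoColouring_hypersurface_of_isDomain` (`HypersurfaceBranchColouring.lean`, p366026),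
  `DualNumberBranchLift` (p361634), `SpecialisationPurity` (p367660), `GrothendieckConnectedness_holds`.
SUPPORTING ROWS (NOT numbered negatives; W4's object-level rows in the KINDS grammar, ROSTER-W4-ANNEX-w4lat1g20.md 84b4c7c7b1461995,
pointed to by t-1's ADDENDUM 1; outside the tree — markdown / machine record — cited with W4's quoted tiers): W4-Σ1 THEOREM KS and
W4-Σ2 KS⁺ (every class-exact letter design / gluing on the type-II corner `S_B ⊂ S_K` of R1: `e_K = 9 − 6 = 3` exactly; n-free
`n(n−1)/2`, 15 at the rung n = 6 — «computed ×1 + transcribed ×1» per t-1), W4-Σ3 (COROLLARY DA / M10), W4-Σ4 (THEOREM HC6), W4-Σ5/Σ6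
(EX4-DEAD / EX5-DEAD, internal ∄-lemmas, EX5 partly open), W4-B1 (LAW B / BOXSPLIT: K-secant / box shapes W-alive class-exact iff
`δ ∈ Nm` — the class-level reading of NEG #1), W4-B2 (W-selection rules / 21-residue class-exactness), W4-B3 (honest-complex floors),
W4-V1 (h-free boxes, CONDITIONAL on `VoisinBarrierHFree`), W4-O1 (the Postnikov door (8a): OPEN, decision quantity = ¬`RigidityExcessPos`
at the staircase placement), W4-O2 (law-locus objects: OPEN pencil expectation `e_K ≥ 4`).  Tree shapes offered beside the roster
(placement the pen's): `ObstructionLocus.ReduciblePointObject.not_semiregular_of_nontrivial_type` / `…_of_pair_type`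
(`ObstructionLocusGraph.lean`, every `n ≥ 3`, modulo (H-arr), (H-NC), connectedness — the (Σ) mechanism at the reducible point),
`ObstructionLocusKodaira.lean` (`finrank_ker_kodairaMap`, `finrank_range_kodairaMap_pp`),
`Literature/AlgebraicGeometry/HodgeTheory/WeilTransverseObstruction.lean` (LADDER C64).
CREDIT: KS-TEST (i) (`ob_mem_ker`, `range_ob_le_ker`, `ob_eq_zero_of_injective`) = LEMMA KS-OB (s4-search-2 g0, bus l.10216), th-5's
(F0) «first-order liftability along all Weil directions», gs-eng-1's CONFINEMENT, W4's THEOREM KS / KS⁺ mechanism ((W9.1)), and the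
hypothesis shape (H-NC) of `ObstructionLocusGraph.lean`; the words are W4's (OBSTRUCTION-W4INPUT-w4lat1g20.md §0/§2/§4).
-/

open Module

namespace Summit.Ventures.HSemireg.WeilObstruction

variable (F : Type*) [Field F]
variable (TSK E2 Tgt : Type*) [AddCommGroup TSK] [Module F TSK] [AddCommGroup E2] [Module F E2] [AddCommGroup Tgt] [Module F Tgt]

/-- **The linear-algebra datum of a candidate Weil representative `G` on a polarised Weil-type abelian variety `A`** (everything
the first-order argument uses; abstract carriers): `TSK` = `T_A S_K` (tangent space of the POLARISED Weil family, dimension `n²`),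
`E2` = `Ext²(G, G)`, `Tgt` = `⊕_q H^{q+2}(A, Ω^q)`; `ob κ = ⟨κ, At G⟩` (obstruction to carrying `G` along `κ`), `sigma = σ_G`,
`contr κ = ± κ ⌟ ch(G)`; `classExact`, `wCarrying` (= «`W_K`-component of `ch_n(G)` non-zero»), `hFree` as in the module
docstring (degree-wise, rational). -/
structure WeilRepresentativeDatum where
  /-- `ob_G = ⟨·, At G⟩ : T_A S_K → Ext²(G,G)` ([BF03] Prop. 4.4). -/
  ob : TSK →ₗ[F] E2
  /-- the semiregularity map `σ_G : Ext²(G,G) → ⊕_q H^{q+2}(Ω^q)`. -/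
  sigma : E2 →ₗ[F] Tgt
  /-- contraction with the Chern character, restricted to the Weil directions: `κ ↦ ± κ ⌟ ch(G)`. -/
  contr : TSK →ₗ[F] Tgt
  /-- CLASS-EXACT: `ch_k(G) ∈ ℚ·h^k` for `k ≠ n` (`0 ≤ k ≤ 2n`) and `ch_n(G) ∈ ℚ·hⁿ ⊕ W_K ⊗ ℂ` (rational classes). -/
  classExact : Prop
  /-- the `W_K`-component of `ch_n(G)` is non-zero (RELEVANCE hypothesis: `G` represents a Weil class). -/
  wCarrying : Prop
  /-- `h`-FREE in the sense of `VoisinBarrierHFree`: `ch_k(G) = 0` for `0 < k < 2n`, `k ≠ n`, and `ch_n(G) ∈ W_K ⊗ ℂ` (rank and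
  point class unconstrained). -/
  hFree : Prop

namespace WeilRepresentativeDatum

variable {F TSK E2 Tgt}
variable (D : WeilRepresentativeDatum F TSK E2 Tgt)

/-- **(H-BF) Buchweitz–Flenner's identity** `σ_G(⟨κ, At G⟩) = ± κ ⌟ ch(G)` ([BF03] Prop. 4.2 / Cor. 4.3, pp. 166–167), as a NAMED
HYPOTHESIS SHAPE on the datum (not a Lean theorem, not a Literature fact here). -/
def HBF : Prop := ∀ κ, D.sigma (D.ob κ) = D.contr κ

/-- **(H-H) THEOREM H in datum form**: for a class-exact `G`, `κ ⌟ ch(G) = 0` for every polarised Weil direction `κ ∈ T_A S_K`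
(`h` and `W_K` stay Hodge along `S_K`; gs-eng-2 LATTICE-FIRST §3, ×2).  NAMED HYPOTHESIS SHAPE. -/
def HH : Prop := D.classExact → D.contr = 0

/-- **(H-V) the Voisin barrier in datum form**: an `h`-free `W`-carrying `G` is not semiregular.  NAMED HYPOTHESIS SHAPE = the
conclusion of the (V) prong itself: DISCHARGED, for finite locally free carriers, by `VoisinBarrierHFree.not_isISemiregular_univ` —
CONDITIONAL on the cell's OPEN `@[conjecture]` statement `VoisinBarrierHFree` (GLOBAL mechanism, no first-order shadow); words only
for complexes. -/
def HV : Prop := D.hFree → D.wCarrying → ¬ Function.Injective D.sigma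

/-- **positive RIGIDITY EXCESS**: some polarised Weil direction obstructs `G` to first order (`e_K(G) > 0`). -/
def RigidityExcessPos : Prop := ∃ κ, D.ob κ ≠ 0

/-- the rigidity excess `e_K(G) := rank(ob_G ∣ T_A S_K)`. -/
noncomputable def rigidityExcess : ℕ := finrank F (LinearMap.range D.ob)

/-- **THE ONE STATEMENT's antecedent — `Obstruction D`: `G` is a Weil representative (class-exact, `W`-carrying) which is EITHER
`h`-free (Voisin prong (V)) OR first-order obstructed along some polarised Weil direction (rigidity prong (Σ))**.  The class-arithmetic
prong (B) of the roster is the statement that a family has NO member with `classExact ∧ wCarrying` at all on a non-split component —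
it enters through the instances, not through this predicate. -/
def Obstruction : Prop := D.classExact ∧ D.wCarrying ∧ (D.hFree ∨ D.RigidityExcessPos)

/-- KS-TEST (i) (= LEMMA KS-OB, s4-search-2; th-5 (F0)): under (H-BF) and (H-H), every obstruction class `⟨κ, At G⟩` of a
class-exact `G` lies in `ker σ_G`. -/
theorem ob_mem_ker (hBF : D.HBF) (hH : D.HH) (hce : D.classExact) (κ : TSK) : D.ob κ ∈ LinearMap.ker D.sigma := by
  rw [LinearMap.mem_ker, hBF κ, hH hce, LinearMap.zero_apply]

/-- hence `range ob_G ≤ ker σ_G` for class-exact `G`. -/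
theorem range_ob_le_ker (hBF : D.HBF) (hH : D.HH) (hce : D.classExact) : LinearMap.range D.ob ≤ LinearMap.ker D.sigma := by
  rintro _ ⟨κ, rfl⟩
  exact D.ob_mem_ker hBF hH hce κ

/-- **THE ONE STATEMENT (lemma form): under (H-BF), (H-H), (H-V), an obstructed Weil representative is NOT semiregular —
`Obstruction D → ¬ Injective σ_G`.**  Rigidity disjunct: `⟨κ, At G⟩ ≠ 0` lies in `ker σ_G` (three lines); Voisin disjunct: (H-V). -/
theorem not_injective_of_obstruction (hBF : D.HBF) (hH : D.HH) (hV : D.HV) (h : D.Obstruction) :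
    ¬ Function.Injective D.sigma := by
  obtain ⟨hce, hW, hfree | ⟨κ, hκ⟩⟩ := h
  · exact hV hfree hW
  · intro hinj
    apply hκ
    have h0 : D.sigma (D.ob κ) = D.sigma 0 := by rw [map_zero]; exact D.ob_mem_ker hBF hH hce κ
    exact hinj h0

/-- … and then NO PART `(σ_q)_{q ∈ I}` of the semiregularity map is injective either (`π` = the projection to the components in `I`;
cf. `IsISemiregular` of `Literature/…/SemiregularityHigherSigma.lean`, every `I`). -/
theorem not_injective_comp_of_obstruction {TgtI : Type*} [AddCommGroup TgtI] [Module F TgtI] (π : Tgt →ₗ[F] TgtI)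
    (hBF : D.HBF) (hH : D.HH) (hV : D.HV) (h : D.Obstruction) : ¬ Function.Injective (π ∘ₗ D.sigma) :=
  fun hinj => D.not_injective_of_obstruction hBF hH hV h (fun a b hab => hinj (by rw [LinearMap.comp_apply, LinearMap.comp_apply, hab]))

/-- KS-TEST (i), contrapositive: a SEMIREGULAR class-exact `G` is first-order unobstructed along ALL polarised Weil directions
(«as flexible as the period point»). -/
theorem ob_eq_zero_of_injective (hBF : D.HBF) (hH : D.HH) (hce : D.classExact) (hinj : Function.Injective D.sigma) :
    D.ob = 0 := by
  ext κ
  have h0 : D.sigma (D.ob κ) = D.sigma 0 := by rw [map_zero]; exact D.ob_mem_ker hBF hH hce κ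
  exact hinj h0

/-- **THE WORDS' «ONLY IF (i) AND (ii)» LITERALLY**: under (H-BF), (H-H), (H-V), a SEMIREGULAR Weil representative (class-exact,
`W`-carrying, `σ_G` injective) is NOT `h`-free and is first-order unobstructed along every polarised Weil direction. -/
theorem necessary_of_injective (hBF : D.HBF) (hH : D.HH) (hV : D.HV) (hce : D.classExact) (hW : D.wCarrying)
    (hinj : Function.Injective D.sigma) : ¬ D.hFree ∧ D.ob = 0 :=
  ⟨fun hfree => hV hfree hW hinj, D.ob_eq_zero_of_injective hBF hH hce hinj⟩

/-- KS-TEST (ii), quantitative: **`dim ker σ_G ≥ e_K(G)`** for class-exact `G` (finite-dimensional `Ext²`). -/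
theorem finrank_ker_sigma_ge [FiniteDimensional F E2] (hBF : D.HBF) (hH : D.HH) (hce : D.classExact) :
    D.rigidityExcess ≤ finrank F (LinearMap.ker D.sigma) :=
  Submodule.finrank_mono (D.range_ob_le_ker hBF hH hce)

/-- KS-TEST (iii): **GOVERNED BY A STRUCTURE** — if `ob_G(κ) = 0` forces `κ` into the tangent space `TS𝔖 ⊆ T_A S_K` of a sub-family
(hypothesis shape (H-arr) of `ObstructionLocusGraph`; REP-FIRST (W9.1) for letter objects), then **`e_K(G) ≥ dim T_A S_K − dim T_A S_𝔖`**
(rank–nullity); e.g. `9 − 6 = 3` at the type-II corner of R1, `n² − n(n+1)/2 = n(n−1)/2` in general. -/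
theorem rigidityExcess_ge_of_governed [FiniteDimensional F TSK] (TS𝔖 : Submodule F TSK)
    (hgov : ∀ κ, D.ob κ = 0 → κ ∈ TS𝔖) : finrank F TSK - finrank F TS𝔖 ≤ D.rigidityExcess := by
  have hker : LinearMap.ker D.ob ≤ TS𝔖 := fun κ hκ => hgov κ (LinearMap.mem_ker.mp hκ)
  have h1 := Submodule.finrank_mono hker
  have h2 := LinearMap.finrank_range_add_finrank_ker D.ob
  rw [rigidityExcess]
  omega

/-- hence a governed `G` with a PROPER governing sub-family (`dim T_A S_𝔖 < dim T_A S_K = n²`) has positive rigidity excess, so is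
obstructed as soon as it is a Weil representative. -/
theorem rigidityExcessPos_of_governed [FiniteDimensional F TSK] (TS𝔖 : Submodule F TSK)
    (hgov : ∀ κ, D.ob κ = 0 → κ ∈ TS𝔖) (hlt : finrank F TS𝔖 < finrank F TSK) : D.RigidityExcessPos := by
  by_contra h
  have h0 : ∀ κ, D.ob κ = 0 := fun κ => by
    by_contra hκ
    exact h ⟨κ, hκ⟩
  have htop : (⊤ : Submodule F TSK) ≤ TS𝔖 := fun κ _ => hgov κ (h0 κ)
  have := Submodule.finrank_mono htop
  rw [finrank_top] at this
  omega

end WeilRepresentativeDatum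

end Summit.Ventures.HSemireg.WeilObstruction
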